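import HarnessLib
import Literature.NumberTheory.LFunctions.DedekindZeta

/-!
# `QuinticDedekindPole` (stmt-Langlands-17270) — Negative knowledge: the root hypothesis
# `f(θ) = 0` is load-bearing (`K = ℚ` refutes the statement without it)

Crux-disprover lemma (cdisprove, 2026-08-17) for the crux `QuinticDedekindPole` of route
`DedekindQuotient1951`:
`∀ K θ, f(θ) = 0 → ℚ(θ) = K → ¬ ∃ g, DifferentiableOn ℂ g {0 < Re s ∧ |Im s| < 100} ∧
  ∀ s, 1 < Re s → |Im s| < 100 → g s * ζ s = ζ_K s`
(`f` the Doud–Moore quintic; "`ζ_K/ζ` has a pole in the box", i.e. Artin's conjecture fails for the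
`4`-dimensional `A₅`-representation below height `100` — no `¬`-theorem of the crux itself is
kernel-reachable: its negation is Dedekind's conjecture for the totally real `A₅` quintic up to
height `100`, decidable only by certified numerics).  This file fences the binders: with the root
hypothesis DROPPED the statement is false, witnessed by `K = ℚ = ℚ(0)` and `g = 1`, because the
Dirichlet series of `ζ_ℚ` is `riemannZeta` on `Re s > 1`
(`Literature.NumberTheory.LFunctions.dedekindZeta_rat_eq_riemannZeta`).  So any proof of the crux
must use that `θ` is a root of the quintic (equivalently, by the companion file
`RatExcludedByFrobHyp` of the sibling crux, that `K` is the quintic field).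
No statement of the route is used or asserted. [folklore]
-/

set_option linter.dupNamespace false -- project-wide option (lakefile weak.linter.dupNamespace); `Summit.Langlands.Langlands` is the mandated namespace

noncomputable section

open Literature.NumberTheory.LFunctions

namespace Summit.Langlands.Langlands.Theorems.QuinticDedekindPole.Negative

/-- Over `ℚ` every intermediate field is `⊤`; in particular `ℚ = ℚ(0)`. [folklore] -/
theorem adjoin_rat_zero_eq_top : IntermediateField.adjoin ℚ ({(0 : ℚ)} : Set ℚ) = ⊤ :=
  eq_top_iff.mpr fun x _ => by
    simpa using (IntermediateField.adjoin ℚ ({(0 : ℚ)} : Set ℚ)).algebraMap_mem x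

/-- **The root hypothesis of `QuinticDedekindPole` is load-bearing.** The crux with `f(θ) = 0`
dropped — "for every number field `K = ℚ(θ)`, `ζ_K/ζ` is not holomorphic on the box" — is FALSE:
`K = ℚ`, `θ = 0`, `g = 1` (`ζ_ℚ = ζ` on `Re s > 1`, `dedekindZeta_rat_eq_riemannZeta`). [folklore] -/
theorem quinticDedekindPole_false_without_root :
    ¬ ∀ (K : Type) [Field K] [NumberField K] (θ : K),
        IntermediateField.adjoin ℚ ({θ} : Set K) = ⊤ →
        ¬ ∃ g : ℂ → ℂ, DifferentiableOn ℂ g {s : ℂ | 0 < s.re ∧ |s.im| < 100} ∧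
          ∀ s : ℂ, 1 < s.re → |s.im| < 100 →
            g s * riemannZeta s = NumberField.dedekindZeta K s := by
  intro h
  refine h ℚ 0 adjoin_rat_zero_eq_top ⟨fun _ => 1, differentiableOn_const 1, fun s hs _ => ?_⟩
  rw [one_mul, dedekindZeta_rat_eq_riemannZeta hs]

end Summit.Langlands.Langlands.Theorems.QuinticDedekindPole.Negative

end
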